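import Summits.QuantumFields.YangMills.Theorems.AllWindowsColdBoxDirichletCombSumsLinear
import Summits.QuantumFields.YangMills.Theorems.WeakCouplingRatesColdBoxDirichletWick

/-!
# LINE-18 v5 of crux `BulkMidWindowSU2` (stmt-QuantumFields-24006), toward half 1 of stub S4 (`K1 → C → K2`) — part 3a:
# the covariance configuration `e ↦ E_D[circ_{p₀} · s_e]` and the response bound up to the kernel's ℓ¹ mass

For the Dirichlet Gaussian `boxDirichlet H` and a fixed plaquette key `p₀`, the edge function
`v(e) := ∫ dirCirc H p₀ · (dirGlue H s)(e) d(boxDirichlet H)` (covariance of the circulation of `p₀` with the glued free variable on `e`) is an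
admissible configuration of the abstract comb setting of `…DirichletCombBounds[Linear]`: it vanishes off the cold box and on the interior temporal
forest (the glued variable does), and by linearity of the integral its circulation around any plaquette `q` is the kernel entry
`E_D[circ_{p₀} circ_q] = boxDirProjKernel H p₀ q` (`sCirc_covConfig`, from the tree's `integral_dirCirc_mul`).  Hence the ℓ¹ comb inequality
`sum_abs_boxEdges_le` of part 2 gives the RESPONSE BOUND UP TO THE KERNEL'S ℓ¹ MASS:
`Σ_{e free} |E_D[circ_{p₀} · s_e]| ≤ 132·H·Σ_{q ∈ enlarged box} |boxDirProjKernel H p₀ q|` (`sum_abs_cov_le_kernelMass`, every `p₀`, `H ≥ 1`).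
Part 3b feeds the dipole law K1 and the logarithmic shell sum.  Everything proved, no definition, standard axioms.
HONEST LABEL: helper toward one half of a registered bundle stub of a critic-passed line on the R2ξ″ RECORD-rung crux 24006; no stub, crux, rung or
summit is proved; the Clay Yang–Mills mass gap is NOT proved by any of this.
-/

set_option autoImplicit false

noncomputable section

open MeasureTheory Finset
open scoped Matrix
open Literature.Probability.LatticeModels (Site mem_halfOpenBox halfOpenBox)
open Literature.MathematicalPhysics.QuantumFieldTheory
open Literature.MathematicalPhysics.QuantumFieldTheory.LatticeMaxwell
open Literature.MathematicalPhysics.QuantumFieldTheory.AxialGauge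

namespace Summit.QuantumFields.YangMills.Theorems.AllWindowsColdBox.DirResponse

open Summit.QuantumFields.YangMills.Theorems.WeakCouplingRates
open Summit.QuantumFields.YangMills.Theorems.AllWindowsColdBox.DirPoincare

variable {H : ℕ}

/-- On a free edge the glued variable is the coordinate. -/
theorem dirGlue_ofLp_eq_coord (σ : EuclideanSpace ℝ (DirFree H)) (e : DirFree H) :
    dirGlue H (WithLp.ofLp σ) e.1.1 = WithLp.ofLp σ e :=
  glue_apply_free _ _ e

/-- `circ_{p₀} · (glued variable on e)` is integrable under the Dirichlet Gaussian (a finite sum of products of two coordinates, or zero). -/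
theorem integrable_dirCirc_mul_dirGlue (p₀ : Plaq 4) (e : Literature.MathematicalPhysics.QuantumLattice.ZdEdge 4) :
    Integrable (fun σ : EuclideanSpace ℝ (DirFree H) => dirCirc H p₀ σ * dirGlue H (WithLp.ofLp σ) e) (boxDirichlet H) := by
  classical
  by_cases h : e ∈ boxEdgesAt dirCorner (2 * H + 3)
  · by_cases hp : e ∈ dirFreeEdges H
    · have hidx : ∀ σ : EuclideanSpace ℝ (DirFree H),
          dirGlue H (WithLp.ofLp σ) e = WithLp.ofLp σ ⟨⟨e, h⟩, not_not.2 hp⟩ := fun σ =>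
        dirGlue_ofLp_eq_coord σ ⟨⟨e, h⟩, not_not.2 hp⟩
      simp_rw [hidx, dirCirc_apply, sCirc_glue_zero_eq_sum, Finset.sum_mul]
      refine integrable_finsetSum _ fun f _ => ?_
      simp_rw [mul_assoc]
      exact (integrable_eval_mul_eval_τ f _).const_mul _
    · have h0 : ∀ σ : EuclideanSpace ℝ (DirFree H), dirGlue H (WithLp.ofLp σ) e = 0 := fun σ => by
        rw [dirGlue, glue_apply_pin _ _ h hp]; rfl
      simp_rw [h0, mul_zero]
      exact integrable_zero _ _ _
  · have h0 : ∀ σ : EuclideanSpace ℝ (DirFree H), dirGlue H (WithLp.ofLp σ) e = 0 := fun σ =>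
      glue_apply_of_not_mem _ _ h
    simp_rw [h0, mul_zero]
    exact integrable_zero _ _ _

/-- The covariance configuration vanishes off the cold box. -/
theorem covConfig_eq_zero_of_not_mem (p₀ : Plaq 4) {e : Literature.MathematicalPhysics.QuantumLattice.ZdEdge 4}
    (he : e ∉ boxEdges 4 (2 * H + 1)) :
    (∫ σ, dirCirc H p₀ σ * dirGlue H (WithLp.ofLp σ) e ∂(boxDirichlet H)) = 0 := by
  simp_rw [fun σ : EuclideanSpace ℝ (DirFree H) => dirGlue_eq_zero_of_not_mem (WithLp.ofLp σ) he, mul_zero]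
  exact integral_zero _ _

/-- The covariance configuration vanishes on the interior temporal forest. -/
theorem covConfig_eq_zero_of_forest (p₀ : Plaq 4) {x : Site 4} (hx : ∀ k : Fin 4, 1 ≤ x k ∧ x k + 1 ≤ 2 * (H : ℤ)) :
    (∫ σ, dirCirc H p₀ σ * dirGlue H (WithLp.ofLp σ) (x, 0) ∂(boxDirichlet H)) = 0 := by
  simp_rw [fun σ : EuclideanSpace ℝ (DirFree H) => dirGlue_eq_zero_of_forest (WithLp.ofLp σ) hx, mul_zero]
  exact integral_zero _ _

/-- **The circulations of the covariance configuration are the kernel entries**: `circ_q(v) = E_D[circ_{p₀} circ_q] = K_H(p₀, q)`. -/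
theorem sCirc_covConfig (p₀ q : Plaq 4) :
    sCirc (fun e => ∫ σ, dirCirc H p₀ σ * dirGlue H (WithLp.ofLp σ) e ∂(boxDirichlet H)) q = boxDirProjKernel H p₀ q := by
  have hI := fun e => integrable_dirCirc_mul_dirGlue (H := H) p₀ e
  set A : EuclideanSpace ℝ (DirFree H) → ℝ := fun σ => dirCirc H p₀ σ * dirGlue H (WithLp.ofLp σ) (q.1, q.2.1) with hA
  set B : EuclideanSpace ℝ (DirFree H) → ℝ :=
    fun σ => dirCirc H p₀ σ * dirGlue H (WithLp.ofLp σ) (q.1 + Pi.single q.2.1 1, q.2.2) with hB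
  set C : EuclideanSpace ℝ (DirFree H) → ℝ :=
    fun σ => dirCirc H p₀ σ * dirGlue H (WithLp.ofLp σ) (q.1 + Pi.single q.2.2 1, q.2.1) with hC
  set D : EuclideanSpace ℝ (DirFree H) → ℝ := fun σ => dirCirc H p₀ σ * dirGlue H (WithLp.ofLp σ) (q.1, q.2.2) with hD
  have hAi : Integrable A (boxDirichlet H) := hI _
  have hBi : Integrable B (boxDirichlet H) := hI _
  have hCi : Integrable C (boxDirichlet H) := hI _
  have hDi : Integrable D (boxDirichlet H) := hI _
  have hK : boxDirProjKernel H p₀ q = ∫ σ, dirCirc H p₀ σ * dirCirc H q σ ∂(boxDirichlet H) := by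
    rw [integral_dirCirc_mul]; rfl
  have hpt : (fun σ : EuclideanSpace ℝ (DirFree H) => dirCirc H p₀ σ * dirCirc H q σ) =
      fun σ => A σ + B σ - C σ - D σ := by
    funext σ; simp only [hA, hB, hC, hD]; rw [dirCirc_apply H q, sCirc]; ring
  have e1 : ∫ σ, (A σ + B σ) ∂(boxDirichlet H) = (∫ σ, A σ ∂(boxDirichlet H)) + ∫ σ, B σ ∂(boxDirichlet H) :=
    integral_add hAi hBi
  have e2 : ∫ σ, (A σ + B σ - C σ) ∂(boxDirichlet H) =
      (∫ σ, (A σ + B σ) ∂(boxDirichlet H)) - ∫ σ, C σ ∂(boxDirichlet H) := integral_sub (hAi.add hBi) hCi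
  have e3 : ∫ σ, (A σ + B σ - C σ - D σ) ∂(boxDirichlet H) =
      (∫ σ, (A σ + B σ - C σ) ∂(boxDirichlet H)) - ∫ σ, D σ ∂(boxDirichlet H) :=
    integral_sub ((hAi.add hBi).sub hCi) hDi
  rw [hK, hpt, e3, e2, e1]
  simp only [sCirc, hA, hB, hC, hD]

/-- The free-edge sum of `|w|` is dominated by the sum over all box edges (the free edges inject into the box edges). -/
theorem sum_abs_free_le_sum_boxEdges (w : Literature.MathematicalPhysics.QuantumLattice.ZdEdge 4 → ℝ) :
    ∑ e : DirFree H, |w e.1.1| ≤ ∑ e' ∈ boxEdges 4 (2 * H + 1), |w e'| := by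
  classical
  have hinj : Set.InjOn (fun e : DirFree H => e.1.1) (Finset.univ : Finset (DirFree H)) :=
    fun a _ b _ hab => Subtype.ext (Subtype.ext hab)
  rw [← Finset.sum_image (f := fun e' => |w e'|) hinj]
  refine Finset.sum_le_sum_of_subset_of_nonneg (fun e' he' => ?_) fun _ _ _ => abs_nonneg _
  obtain ⟨e, -, rfl⟩ := Finset.mem_image.1 he'
  exact (mem_dirFreeEdges.1 (not_not.1 e.2)).1

/-- **Response bound up to the kernel's ℓ¹ mass**: for every plaquette key `p₀` and `H ≥ 1`,
`Σ_{e free} |E_D[circ_{p₀} · s_e]| ≤ 132·H·Σ_{q ∈ shift(dirCorner) plaquettesIn {0..2H+2}⁴} |K_H(p₀, q)|`. -/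
theorem sum_abs_cov_le_kernelMass (hH : 1 ≤ H) (p₀ : Plaq 4) :
    ∑ e : DirFree H, |∫ σ, dirCirc H p₀ σ * WithLp.ofLp σ e ∂(boxDirichlet H)| ≤
      132 * (H : ℝ) * ∑ q ∈ (plaquettesIn (halfOpenBox 4 (2 * H + 3))).image (Plaq.shift dirCorner),
        |boxDirProjKernel H p₀ q| := by
  have hmain := sum_abs_boxEdges_le (H := H)
    (fun e => ∫ σ, dirCirc H p₀ σ * dirGlue H (WithLp.ofLp σ) e ∂(boxDirichlet H))
    (fun e he => covConfig_eq_zero_of_not_mem p₀ he) (fun x hx => covConfig_eq_zero_of_forest p₀ hx) hH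
  have hR : ∑ q ∈ (plaquettesIn (halfOpenBox 4 (2 * H + 3))).image (Plaq.shift dirCorner),
      |sCirc (fun e => ∫ σ, dirCirc H p₀ σ * dirGlue H (WithLp.ofLp σ) e ∂(boxDirichlet H)) q| =
      ∑ q ∈ (plaquettesIn (halfOpenBox 4 (2 * H + 3))).image (Plaq.shift dirCorner), |boxDirProjKernel H p₀ q| :=
    Finset.sum_congr rfl fun q _ => by rw [sCirc_covConfig]
  rw [hR] at hmain
  have h2 := sum_abs_free_le_sum_boxEdges (H := H)
    (fun e' => ∫ σ, dirCirc H p₀ σ * dirGlue H (WithLp.ofLp σ) e' ∂(boxDirichlet H))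
  have h1 : ∑ e : DirFree H, |∫ σ, dirCirc H p₀ σ * WithLp.ofLp σ e ∂(boxDirichlet H)| =
      ∑ e : DirFree H, |∫ σ, dirCirc H p₀ σ * dirGlue H (WithLp.ofLp σ) e.1.1 ∂(boxDirichlet H)| :=
    Finset.sum_congr rfl fun e _ => by simp only [dirGlue_ofLp_eq_coord]
  rw [h1]
  exact h2.trans hmain

end Summit.QuantumFields.YangMills.Theorems.AllWindowsColdBox.DirResponse

end
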